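import Literature.Geometry.Lorentzian.KerrSchildCutoffCurrent

/-!
# Crux `AdiabaticMultiKerrILED` (line `Sketch`) — the modified bulk of a cut-off multiplier pair

Helper file for the crux `stmt-FinalStateConjecture-14310`
(`Summit.FinalStateConjecture.FinalStateConjecture.Theses.ClusterCompleteness.AdiabaticMultiKerrILED`),
far-field stub `stub_farTransport`: the lab-centred Morawetz pair `(X, ϖ)` is cut off by a smooth `ζ`
vanishing inside the near zones, and the energy identity is run for `(ζX, ζϖ)`. Pointwise algebra for
the divergence-form wave operator `□_G` of a coefficient field `G` (`KerrSchild.waveOperator`) and the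
currents of `KerrSchildMultiplierCurrent.lean`:

* `waveOperator_mul` — **Leibniz rule** `□_G (f g) = f □_G g + g □_G f + 2 ∑ G^{μν} ∂_μf ∂_νg`
  (`G` differentiable and symmetric at the point, `f`, `g` of class `C²` there);
* `modifiedBulk_cutoff_eq` — **the modified bulk of the cut-off pair**:
  `K^{ζX} + ¼ (ζϖ) Q − ⅛ □_G(ζϖ) w² = ζ (K^X + ¼ ϖ Q − ⅛ (□_G ϖ) w²)
     + ∑_μ (∂_μζ) (J^X)^μ − ⅛ (2 ∑ G^{μν}∂_μζ∂_νϖ + ϖ □_G ζ) w²`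
  (`K` = `KerrSchild.multiplierBulk`, `J^X` = `KerrSchild.multiplierCurrent`,
  `Q = ∑ G^{αβ}∂_αw∂_βw`): the error is supported where `dζ ≠ 0` or `□ζ ≠ 0`. [folklore]
-/

noncomputable section

-- the doubled `FinalStateConjecture.FinalStateConjecture` path component trips dupNamespace
set_option linter.dupNamespace false

open scoped ContDiff Topology
open Filter Set Literature.Geometry.Lorentzian Literature.Geometry.Lorentzian.KerrSchild

namespace Summit.FinalStateConjecture.FinalStateConjecture.Cruxes.AdiabaticMultiKerrILED.Sketch

/-! ### Leibniz rule for the divergence-form wave operator -/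

/-- **`□_G (f g) = f □_G g + g □_G f + 2 ∑_{μν} G^{μν} ∂_μ f ∂_ν g`** at a point where `G` is
differentiable and symmetric and `f`, `g` are `C²`. [folklore] -/
theorem waveOperator_mul {G : E4 → Fin 4 → Fin 4 → ℝ} {f g : E4 → ℝ} {x : E4}
    (hG : ∀ μ ν, DifferentiableAt ℝ (fun y ↦ G y μ ν) x) (hsymm : ∀ μ ν, G x μ ν = G x ν μ)
    (hf : ContDiffAt ℝ 2 f x) (hg : ContDiffAt ℝ 2 g x) :
    waveOperator G (fun y ↦ f y * g y) x =
      f x * waveOperator G g x + g x * waveOperator G f x +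
        2 * ∑ μ, ∑ ν, G x μ ν * fderiv ℝ f x (E4.basisVector μ) * fderiv ℝ g x (E4.basisVector ν) := by
  -- `A_u^μ = ∑_ν G^{μν} ∂_ν u`
  set Af : Fin 4 → E4 → ℝ := fun μ y ↦ ∑ ν, G y μ ν * fderiv ℝ f y (E4.basisVector ν) with hAf
  set Ag : Fin 4 → E4 → ℝ := fun μ y ↦ ∑ ν, G y μ ν * fderiv ℝ g y (E4.basisVector ν) with hAg
  have hf1 : DifferentiableAt ℝ f x := hf.differentiableAt (by simp)
  have hg1 : DifferentiableAt ℝ g x := hg.differentiableAt (by simp)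
  have hdcoord : ∀ {u : E4 → ℝ}, ContDiffAt ℝ 2 u x → ∀ κ,
      DifferentiableAt ℝ (fun y ↦ fderiv ℝ u y (E4.basisVector κ)) x := by
    intro u hu κ
    have hu2 : DifferentiableAt ℝ (fderiv ℝ u) x :=
      (hu.fderiv_right (m := 1) le_rfl).differentiableAt one_ne_zero
    exact hu2.clm_apply (differentiableAt_const _)
  have hdAf : ∀ μ, DifferentiableAt ℝ (Af μ) x := fun μ ↦
    DifferentiableAt.fun_sum fun ν _ ↦ (hG μ ν).mul (hdcoord hf ν)
  have hdAg : ∀ μ, DifferentiableAt ℝ (Ag μ) x := fun μ ↦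
    DifferentiableAt.fun_sum fun ν _ ↦ (hG μ ν).mul (hdcoord hg ν)
  -- near `x`, `f` and `g` are differentiable, so `A_{fg} = f A_g + g A_f` there
  have hfn : ∀ᶠ y in 𝓝 x, DifferentiableAt ℝ f y := by
    have h := hf.eventually (by simp : (2 : WithTop ℕ∞) ≠ ∞)
    filter_upwards [h] with y hy using hy.differentiableAt (by simp)
  have hgn : ∀ᶠ y in 𝓝 x, DifferentiableAt ℝ g y := by
    have h := hg.eventually (by simp : (2 : WithTop ℕ∞) ≠ ∞)
    filter_upwards [h] with y hy using hy.differentiableAt (by simp)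
  have hinner : ∀ μ, (fun y ↦ ∑ ν, G y μ ν * fderiv ℝ (fun z ↦ f z * g z) y (E4.basisVector ν))
      =ᶠ[𝓝 x] fun y ↦ f y * Ag μ y + g y * Af μ y := by
    intro μ
    filter_upwards [hfn, hgn] with y hfy hgy
    have hprod : fderiv ℝ (fun z ↦ f z * g z) y = f y • fderiv ℝ g y + g y • fderiv ℝ f y :=
      (hfy.hasFDerivAt.mul hgy.hasFDerivAt).fderiv
    simp only [hprod, add_apply, smul_apply, smul_eq_mul,
      hAf, hAg, Finset.mul_sum]
    rw [← Finset.sum_add_distrib]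
    exact Finset.sum_congr rfl fun ν _ ↦ by ring
  -- differentiate at `x`
  have hderiv : ∀ μ, fderiv ℝ (fun y ↦ ∑ ν, G y μ ν *
      fderiv ℝ (fun z ↦ f z * g z) y (E4.basisVector ν)) x (E4.basisVector μ) =
      (f x * fderiv ℝ (Ag μ) x (E4.basisVector μ) + fderiv ℝ f x (E4.basisVector μ) * Ag μ x) +
        (g x * fderiv ℝ (Af μ) x (E4.basisVector μ) + fderiv ℝ g x (E4.basisVector μ) * Af μ x) := by
    intro μ
    rw [(hinner μ).fderiv_eq]
    have h1 := hf1.hasFDerivAt.mul (hdAg μ).hasFDerivAt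
    have h2 := hg1.hasFDerivAt.mul (hdAf μ).hasFDerivAt
    have h12 : HasFDerivAt (fun y ↦ f y * Ag μ y + g y * Af μ y) _ x := h1.add h2
    rw [h12.fderiv]
    simp only [add_apply, smul_apply, smul_eq_mul]
    ring
  have hboxf : waveOperator G f x = ∑ μ, fderiv ℝ (Af μ) x (E4.basisVector μ) := rfl
  have hboxg : waveOperator G g x = ∑ μ, fderiv ℝ (Ag μ) x (E4.basisVector μ) := rfl
  have hboxfg : waveOperator G (fun y ↦ f y * g y) x = ∑ μ, fderiv ℝ (fun y ↦ ∑ ν, G y μ ν *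
      fderiv ℝ (fun z ↦ f z * g z) y (E4.basisVector ν)) x (E4.basisVector μ) := rfl
  rw [hboxfg, hboxf, hboxg]
  simp only [hderiv]
  -- the cross terms: `∑_μ ∂_μf A_g^μ = ∑ G ∂f ∂g` and `∑_μ ∂_μg A_f^μ = ∑ G ∂f ∂g` (symmetry)
  have hc1 : ∑ μ, fderiv ℝ f x (E4.basisVector μ) * Ag μ x =
      ∑ μ, ∑ ν, G x μ ν * fderiv ℝ f x (E4.basisVector μ) * fderiv ℝ g x (E4.basisVector ν) := by
    simp only [hAg, Finset.mul_sum]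
    exact Finset.sum_congr rfl fun μ _ ↦ Finset.sum_congr rfl fun ν _ ↦ by ring
  have hc2 : ∑ μ, fderiv ℝ g x (E4.basisVector μ) * Af μ x =
      ∑ μ, ∑ ν, G x μ ν * fderiv ℝ f x (E4.basisVector μ) * fderiv ℝ g x (E4.basisVector ν) := by
    simp only [hAf, Finset.mul_sum]
    rw [Finset.sum_comm]
    exact Finset.sum_congr rfl fun ν _ ↦ Finset.sum_congr rfl fun μ _ ↦ by rw [hsymm μ ν]; ring
  have hsplit : ∑ μ, ((f x * fderiv ℝ (Ag μ) x (E4.basisVector μ) +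
      fderiv ℝ f x (E4.basisVector μ) * Ag μ x) +
        (g x * fderiv ℝ (Af μ) x (E4.basisVector μ) + fderiv ℝ g x (E4.basisVector μ) * Af μ x)) =
      f x * ∑ μ, fderiv ℝ (Ag μ) x (E4.basisVector μ) +
        ∑ μ, fderiv ℝ f x (E4.basisVector μ) * Ag μ x +
        (g x * ∑ μ, fderiv ℝ (Af μ) x (E4.basisVector μ) +
          ∑ μ, fderiv ℝ g x (E4.basisVector μ) * Af μ x) := by
    simp only [Finset.mul_sum, ← Finset.sum_add_distrib]
  rw [hsplit, hc1, hc2]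
  ring

/-! ### The modified bulk of a cut-off multiplier pair -/

/-- **The modified bulk of the cut-off pair `(ζX, ζϖ)`.** At a point where `G` is differentiable and
symmetric, `X` and `ζ` differentiable (`ζ`, `ϖ` of class `C²`):
`K^{ζX} + ¼ (ζϖ) Q − ⅛ □_G(ζϖ) w²
   = ζ (K^X + ¼ ϖ Q − ⅛ (□_G ϖ) w²) + ∑_μ (J^X)^μ ∂_μζ − ⅛ (2 ∑ G^{μν}∂_μζ∂_νϖ + ϖ □_G ζ) w²`.
[folklore] -/
theorem modifiedBulk_cutoff_eq {G : E4 → Fin 4 → Fin 4 → ℝ} {X : E4 → Fin 4 → ℝ}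
    {ζ ϖ : E4 → ℝ} (w : E4 → ℝ) {x : E4}
    (hG : ∀ μ ν, DifferentiableAt ℝ (fun y ↦ G y μ ν) x) (hsymm : ∀ μ ν, G x μ ν = G x ν μ)
    (hX : ∀ α, DifferentiableAt ℝ (fun y ↦ X y α) x) (hζ : ContDiffAt ℝ 2 ζ x)
    (hϖ : ContDiffAt ℝ 2 ϖ x) :
    multiplierBulk G (fun y α ↦ ζ y * X y α) w x +
        4⁻¹ * ((ζ x * ϖ x) * ∑ α, ∑ β, G x α β * fderiv ℝ w x (E4.basisVector α) *
          fderiv ℝ w x (E4.basisVector β)) -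
        8⁻¹ * waveOperator G (fun y ↦ ζ y * ϖ y) x * w x ^ 2 =
      ζ x * (multiplierBulk G X w x +
          4⁻¹ * (ϖ x * ∑ α, ∑ β, G x α β * fderiv ℝ w x (E4.basisVector α) *
            fderiv ℝ w x (E4.basisVector β)) -
          8⁻¹ * waveOperator G ϖ x * w x ^ 2) +
        ∑ μ, multiplierCurrent G X w x μ * fderiv ℝ ζ x (E4.basisVector μ) -
        8⁻¹ * (2 * (∑ μ, ∑ ν, G x μ ν * fderiv ℝ ζ x (E4.basisVector μ) *
            fderiv ℝ ϖ x (E4.basisVector ν)) + ϖ x * waveOperator G ζ x) * w x ^ 2 := by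
  rw [multiplierBulk_smul_eq G w (hζ.differentiableAt (by simp)) hX,
    waveOperator_mul hG hsymm hζ hϖ]
  ring

/-- **Where the cut-off is locally constant the error vanishes**: if `dζ(x) = 0` and `□_G ζ (x) = 0`,
the modified bulk of `(ζX, ζϖ)` at `x` is `ζ(x)` times that of `(X, ϖ)`. [folklore] -/
theorem modifiedBulk_cutoff_eq_of_fderiv_eq_zero {G : E4 → Fin 4 → Fin 4 → ℝ} {X : E4 → Fin 4 → ℝ}
    {ζ ϖ : E4 → ℝ} (w : E4 → ℝ) {x : E4}
    (hG : ∀ μ ν, DifferentiableAt ℝ (fun y ↦ G y μ ν) x) (hsymm : ∀ μ ν, G x μ ν = G x ν μ)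
    (hX : ∀ α, DifferentiableAt ℝ (fun y ↦ X y α) x) (hζ : ContDiffAt ℝ 2 ζ x)
    (hϖ : ContDiffAt ℝ 2 ϖ x) (hdζ : fderiv ℝ ζ x = 0) (hboxζ : waveOperator G ζ x = 0) :
    multiplierBulk G (fun y α ↦ ζ y * X y α) w x +
        4⁻¹ * ((ζ x * ϖ x) * ∑ α, ∑ β, G x α β * fderiv ℝ w x (E4.basisVector α) *
          fderiv ℝ w x (E4.basisVector β)) -
        8⁻¹ * waveOperator G (fun y ↦ ζ y * ϖ y) x * w x ^ 2 =
      ζ x * (multiplierBulk G X w x +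
          4⁻¹ * (ϖ x * ∑ α, ∑ β, G x α β * fderiv ℝ w x (E4.basisVector α) *
            fderiv ℝ w x (E4.basisVector β)) -
          8⁻¹ * waveOperator G ϖ x * w x ^ 2) := by
  rw [modifiedBulk_cutoff_eq w hG hsymm hX hζ hϖ, hdζ, hboxζ]
  simp

end Summit.FinalStateConjecture.FinalStateConjecture.Cruxes.AdiabaticMultiKerrILED.Sketch

end
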